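import Literature.AlgebraicGeometry.Hu2025.Statements.S03Pluecker.R101aPlatform
import Literature.AlgebraicGeometry.Hu2025.Statements.S03Pluecker.R102aOrders
import Literature.AlgebraicGeometry.Hu2025.Statements.S04ModelV.R103aModelR
import Literature.AlgebraicGeometry.Hu2025.Statements.S04ModelV.R105aGoverning
import Literature.AlgebraicGeometry.Hu2025.Statements.S04ModelV.R105bCharts
import HarnessLib

/-!
# Hu 2025 (arXiv:2507.21400v1), §4.1/§4.5 at the Plücker platform `Gr^{3,E}`, `p_{(123)} ≡ 1` — the n-INSTANTIATION of the
# generic model data `(σ, T, 𝔗, rel, mono)` of I-R (row 103) and of I-GOV's `(head, sgn)` (row 105) over I-PL / I-ORD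
# (rows 101/102, res-type-009's files). Annex «InstN» of row 105, filed by the row-105 typer of record res-type-079 as
# `S04ModelV/R105cInstN.lean` (the row-103 owner res-type-042 keeps I-R generic and homes the instantiation here, README-hu103
# 2026-08-27T06:5xZ; body of record sha16 65fb044219601a57, HOME/plan/tools/res-type-079/hu/README-hu105-IGOV.md §v4).
# Imports: `…S03Pluecker.R101aPlatform`, `…R102aOrders`, `…S04ModelV.R103aModelR`, `…R105aGoverning`, `…R105bCharts` (for `FbarN`).

**Status of the source (D-0012): UNREFEREED PREPRINT UNDER ADJUDICATION.** Nothing is asserted; these are REAL definitions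
(plumbing abbrevs) `[claim: Hu2025, status: under-review]`. No proofs of printed claims, no `sorry`, no `instance`, no notation.

RECIPE (res-type-009 README-v3 «INSTANTIATION RECIPE», res-type-024 README-hu103-IR «Parameters»): `σ := plVar n` (ϖ-indices
`𝕀_{3,n} ∖ (123)`), `𝔗 := {u : plIndex n // IsLt u.1}` (`𝓕_m ↔ 𝕀^lt_{3,n}`, Def 3.4 correspondence chunk p0018 l.9–15),
`T := Σ F : 𝔗, S_F` with `S_F = C20L5_SF F = Fin |primaryTerms F|` (all terms of all `F̄ ∈ 𝓕` = the ϱ-variable indices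
`(u_s, v_s)` of the blocks `ℙ_F`, chunk p0021 l.16–21), `rel := Sigma.fst`, `mono ⟨F, s⟩ :=` exponent vector of
`x̄_{u_s} x̄_{v_s}` with `x̄_m = 1` (display p0018 l.48–51), `head F := ⟨F, s_F⟩` with `s_F` = position `0` of `primaryTerms F`
(leading term first, chunk p0018 l.38–44), `sgn ⟨F, s⟩ := sgnS F s`.
-/

noncomputable section

namespace Literature.AlgebraicGeometry.Hu2025.Statements.S04ModelV

open MvPolynomial
open Literature.AlgebraicGeometry.Hu2025.Statements.S03Pluecker

universe u

section InstN

/-- **The relation index type `𝔗` of the platform** = `𝕀^lt_{3,n}` («the correspondence 𝕀^lt_{3,n} ⟷ 𝓕_m, u → F_{m,u}», Def. 3.4,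
chunk p0018 l.9–15, p.37) — I-R's `𝔗` at the platform. Plumbing. [claim: Hu2025, status: under-review]
STATUS: candidate statement under adjudication (D-0012/D-0089); not asserted. -/
abbrev RelIdx (n : ℕ) : Type := {u : plIndex n // IsLt u.1}

/-- **The term index type `T` of the platform** = all `s ∈ S_F`, `F̄ ∈ 𝓕` (chunk p0016 l.126–131 «F = Σ_{s ∈ S_F} sgn(s) p_{u_s}p_{v_s}»;
the ϱ-variables «[x_{(u_s,v_s)}]_{s ∈ S_F}» of `ℙ_F`, chunk p0021 l.16–21, p.44) — I-R's `T` at the platform: a block `F` and a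
position in row 101a's term list `primaryTerms F` (row 102a's `C20L5_SF`). Plumbing. [claim: Hu2025, status: under-review]
STATUS: candidate statement under adjudication (D-0012/D-0089); not asserted. -/
abbrev TermIdx (n : ℕ) : Type := Σ F : RelIdx n, C20L5_SF F.1.1

/-- `rel` at the platform: the block `F` of a term. Plumbing. [claim: Hu2025, status: under-review]
STATUS: candidate statement under adjudication (D-0012/D-0089); not asserted. -/
abbrev relN (n : ℕ) : TermIdx n → RelIdx n := Sigma.fst

/-- The printed term datum `(sgn(s), u_s, v_s)` of `s ∈ S_F` (row 101a's `PlTerm`). Plumbing. [claim: Hu2025, status: under-review]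
STATUS: candidate statement under adjudication (D-0012/D-0089); not asserted. -/
def termN {n : ℕ} (t : TermIdx n) : PlTerm := (primaryTerms t.1.1.1).get t.2

/-- The exponent vector of the chart variable `x̄_w` (display p0018 l.48–51, p.38: «x̄_w = x_w if w ≠ m, 1 if w = m»): `𝟙_w` for
`w ∈ 𝕀_{3,n} ∖ (123)`, `0` for `w = m` (and junk `0` off `𝕀_{3,n}`) — so that `monomial (plExp w) 1 = xbar k w` on the platform.
Plumbing. [claim: Hu2025, status: under-review]
STATUS: candidate statement under adjudication (D-0012/D-0089); not asserted. -/
def plExp {n : ℕ} (w : ℕ × ℕ × ℕ) : plVar n →₀ ℕ :=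
  if h : w ∈ plVarSet n then Finsupp.single ⟨w, h⟩ 1 else 0

/-- `mono` at the platform: the exponent vector of the chart monomial `x̄_{u_s} x̄_{v_s}` of the term `s` ((4.7) chunk p0021
l.122–132, p.46: «x_{(u_s,v_s)} ↦ x_{u_s} x_{v_s}»; for the leading term `x̄_u x̄_m = x̄_u`). Plumbing.
[claim: Hu2025, status: under-review]
STATUS: candidate statement under adjudication (D-0012/D-0089); not asserted. -/
def monoN (n : ℕ) (t : TermIdx n) : plVar n →₀ ℕ := plExp (termN t).us + plExp (termN t).vs

/-- I-GOV's `head` at the platform: the LEADING TERM `s_F` of `F` («s_F is the index for the leading term of F», chunk p0016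
l.131; p0018 l.42–44), = position `0` of `primaryTerms F` (row 101a lists the leading term first). Well-definedness datum: each
of the four printed forms has 3 or 4 terms, so position `0` exists for `F ∈ 𝕀^lt` (the embedded term is that arithmetic, not a
printed claim). Plumbing. [claim: Hu2025, status: under-review]
STATUS: candidate statement under adjudication (D-0012/D-0089); not asserted. -/
def headN (n : ℕ) (F : RelIdx n) : TermIdx n :=
  ⟨F, ⟨0, by
    have h : IsLt F.1.1 := F.2
    unfold primaryTerms
    rw [if_pos h]
    split_ifs <;> simp⟩⟩

/-- I-GOV's `sgn` at the platform: `sgn(s)` (row 102a's `sgnS`). Plumbing. [claim: Hu2025, status: under-review]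
STATUS: candidate statement under adjudication (D-0012/D-0089); not asserted. -/
def sgnN (n : ℕ) (t : TermIdx n) : ℤ := sgnS t.1.1.1 t.2

/-- The ring `R = R_{[Υ]}` of Def. 4.3 at the platform (`𝕜[x_w][x_{(u_s,v_s)}]`, chunk p0021 l.107–120, p.46). Plumbing.
[claim: Hu2025, status: under-review]
STATUS: candidate statement under adjudication (D-0012/D-0089); not asserted. -/
abbrev ModelRingN (n : ℕ) (k : Type u) [CommRing k] : Type u := ModelRing (plVar n) (TermIdx n) k

/-- The primary relations `F̄ : 𝔗 → R_0` at the platform (row 101a's `primaryRelBar`; `R0 (plVar n) k = ChartRing n k`), the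
parameter `Fbar` of `Prop4_55` / `Prop4_56`. Plumbing. [claim: Hu2025, status: under-review]
STATUS: candidate statement under adjudication (D-0012/D-0089); not asserted. -/
def FbarN (n : ℕ) (k : Type u) [CommRing k] (F : RelIdx n) : R0 (plVar n) k := primaryRelBar n k F.1.1

/-- **Def. 4.48 at the platform**: the leading ϱ-variable `x_{((123),u_F)}` of `F̄_{m,u}` in `R`. [claim: Hu2025, status: under-review]
STATUS: candidate statement under adjudication (D-0012/D-0089); not asserted. -/
abbrev leadingRhoVarN (n : ℕ) (k : Type u) [CommRing k] (F : RelIdx n) : ModelRingN n k :=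
  leadingRhoVar (k := k) (σ := plVar n) (headN n) F

/-- **Def. 4.50 at the platform**: `𝓑^gov_F`. [claim: Hu2025, status: under-review]
STATUS: candidate statement under adjudication (D-0012/D-0089); not asserted. -/
abbrev BgovN (n : ℕ) (k : Type u) [CommRing k] (F : RelIdx n) : Set (ModelRingN n k) :=
  Bgov (k := k) (relN n) (monoN n) (headN n) F

/-- **Def. 4.50 at the platform**: `𝓑^ngv_F`. [claim: Hu2025, status: under-review]
STATUS: candidate statement under adjudication (D-0012/D-0089); not asserted. -/
abbrev BngvN (n : ℕ) (k : Type u) [CommRing k] (F : RelIdx n) : Set (ModelRingN n k) :=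
  Bngv (k := k) (relN n) (monoN n) (headN n) F

/-- **Def. 4.37 / 4.51 at the platform**: `L_F = Σ_{s ∈ S_F} sgn(s) x_{(u_s,v_s)}`. [claim: Hu2025, status: under-review]
STATUS: candidate statement under adjudication (D-0012/D-0089); not asserted. -/
abbrev linPlN (n : ℕ) (k : Type u) [CommRing k] (F : RelIdx n) : ModelRingN n k :=
  linPl (k := k) (σ := plVar n) (relN n) (sgnN n) F

/-- **Def. 4.52 at the platform**: the block `𝔊_F = 𝓑^gov_F ⊔ {L_F}`. [claim: Hu2025, status: under-review]
STATUS: candidate statement under adjudication (D-0012/D-0089); not asserted. -/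
abbrev blockGN (n : ℕ) (k : Type u) [CommRing k] (F : RelIdx n) : Set (ModelRingN n k) :=
  blockG (k := k) (relN n) (monoN n) (headN n) (sgnN n) F

/-- **Def. 4.53 at the platform**: the triple (`𝓓_ϖ`, `𝓓_ϱ`, `𝓓_𝔏`) by equations. [claim: Hu2025, status: under-review]
STATUS: candidate statement under adjudication (D-0012/D-0089); not asserted. -/
abbrev Def4_53N (n : ℕ) (k : Type u) [CommRing k] :
    Set (ModelRingN n k) × Set (ModelRingN n k) × Set (ModelRingN n k) :=
  Def4_53 (k := k) (σ := plVar n) (relN n) (sgnN n)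

end InstN

end Literature.AlgebraicGeometry.Hu2025.Statements.S04ModelV

end
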